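import Literature.AlgebraicGeometry.AbelianSchemes.LevelStructureOfTorsionBasis
import Literature.AlgebraicGeometry.AbelianSchemes.DualPairHatRelDimTransport
import Literature.AlgebraicGeometry.Motives.AbelianVarietyTorsionStructure
import HarnessLib

/-!
# Every abelian scheme over an algebraically closed field carries a level-`n` structure, `n` invertible
# ([MumfordFogartyKirwan1994] Ch. 7 §2 Def. 7.1; [MumfordAV1970] §6 App. 3; [SerreTate1968] §1; [Lang1983AbelianVarieties] VII §1)

Topic `Literature/AlgebraicGeometry/AbelianSchemes`; namespace `Literature.AlgebraicGeometry.AbelianSchemes.AbelianSchemeOver`.  THEOREMS ONLY (no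
definition, no named fact, no instance, no notation, no `sorry`).  Cell `hodgecm-mathlib` (D-0151), P6 «MOD» (crux hLiu418 = stmt-HodgeConjecture-24832,
`--supports`, count-neutral): line L3 (`stub_FROB`), ROOF road (ρ-𝔟), LA3-plan deal 04:03:26Z head **H6 «LEVEL-κ̄»** — the level-`n` input `φ` of the
★ quotient-dual engine `universal_poincareQuotRigid_of_level` over the algebraically closed point `Spec κ̄(w)` (consumed at `A := D.hat`, `n` prime to
`p` from ★ `IdealClassCoprimeRepresentative.exists_nat_mem_not_dvd`): **`nonempty_levelStructure_of_isAlgClosed`** — for `Ω` algebraically closed,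
`A` an abelian scheme over `Spec Ω` of relative dimension `g` and `(n : Ω) ≠ 0`, `Nonempty (LevelStructure g n A)`.  HC_CM is proved only modulo the
printed citations until rung 0 closes; this file is generic and changes no count.

THE MATHEMATICS.  [MumfordAV1970] §6 App. 3 ∕ [SerreTate1968] §1: `A[n](Ω) ≅ (ℤ∕n)^{2g}` for `n` invertible in the algebraically closed `Ω`; a
`ℤ∕n`-basis is `2g` `n`-torsion `Ω`-points on which `a ↦ Σ aᵢ xᵢ` is injective, i.e. ([MumfordFogartyKirwan1994] Def. 7.1) a level-`n` structure
(★ `LevelStructure.exists_of_torsionBasis`, which checks the basis clauses at EVERY geometric point `Spec Ω′ → Spec Ω`, «torsion does not grow»).  The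
structure `A[n](Ω) ≅ (ℤ∕n)^{2g}` is assembled from the COUNTS `#A[d](Ω) = d^{2g}` (`d ∣ n`; ★ `natCard_torsionPoints_eq_of_isAlgClosed`, Mumford §6) by
Lang's argument at prime powers (★ `TateModule.nonempty_torsionBy_addEquiv_pi_zmod_of_card`) and the primary decomposition (★ `nonempty_torsionBy_mul_addEquiv_prod`)
— exactly the road of ★ `AbelianVariety.nonempty_geomTorsion_addEquiv_pi_zmod` (stated there for `K̄`-points; here for the `Ω`-points of an abelian
variety over an algebraically closed `Ω`, which is what Def. 7.1's SECTIONS over `Spec Ω` are).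

* §1 (any `AddCommGroup G`) `nonempty_torsionBy_addEquiv_pi_zmod_of_card_primePow` — `G[n] ≃+ (ℤ∕n)^d` from `#G[p^m] = p^{dm}` for the primes `p ∣ n`.
* §2 (`A₀` an abelian variety over an algebraically closed `Ω`) `natCard_torsionBy_additive_points` (`#(Additive A₀(Ω))[n] = n^{2 dim}`),
  `nonempty_torsionBy_additive_points_addEquiv_pi_zmod` (`A₀(Ω)[n] ≃+ (ℤ∕n)^{2 dim}`), **`exists_torsionBasis`** (a `ℤ∕n`-basis `x : Fin g ⊕ Fin g → A₀(Ω)`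
  in the `List.ofFn`-product currency of ★ `LevelStructure.exists_of_torsionBasis`).
* §3 the HEAD **`nonempty_levelStructure_of_isAlgClosed`** (`dim A_Ω = g` by ★ `DualPairHatRelDimTransport.dim_toAffine_toAbelianVariety_of_isOfRelDim`), and
  `exists_levelStructure_of_isAlgClosed` (`∃`-form with the `Ω`-points underlying the sections).

## References
* [MumfordFogartyKirwan1994] D. Mumford, J. Fogarty, F. Kirwan, *Geometric Invariant Theory*, 3rd ed. (1994), Ch. 7 §2 Definition 7.1 (p. 129).
* [MumfordAV1970] D. Mumford, *Abelian Varieties* (1970), §6 Application 3 (Proposition p. 64).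
* [SerreTate1968] J.-P. Serre, J. Tate, *Good reduction of abelian varieties*, Ann. of Math. 88 (1968), §1 (p. 493).
* [Lang1983AbelianVarieties] S. Lang, *Abelian Varieties* (1983), Ch. VII §1 Prop. 1.
-/

set_option autoImplicit false

universe u v

open CategoryTheory CategoryTheory.Limits AlgebraicGeometry

noncomputable section

namespace Literature.AlgebraicGeometry.AbelianSchemes

namespace AbelianSchemeOver

open Literature.AlgebraicGeometry.Motives (AbelianVariety)
open Literature.NumberTheory.EllipticCurves (TateModule)

/-! ### §1 `G[n] ≃+ (ℤ∕n)^d` from the prime-power torsion counts -/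

/-- CRT on the coefficients: `(ℤ/a)^d × (ℤ/b)^d ≃+ (ℤ/ab)^d` for coprime `a, b` (Mathlib `ZMod.chineseRemainder`; the tree's `private`
`piZModProdAddEquiv` restated). [cite: SerreTate1968, §1 (p. 493)] -/
theorem nonempty_pi_zmod_prod_addEquiv (d : ℕ) {a b : ℕ} (hab : a.Coprime b) :
    Nonempty ((Fin d → ZMod a) × (Fin d → ZMod b) ≃+ (Fin d → ZMod (a * b))) :=
  ⟨{ toFun := fun fg i => ((ZMod.chineseRemainder hab).symm (fg.1 i, fg.2 i))
     invFun := fun h => (fun i => ((ZMod.chineseRemainder hab) (h i)).1, fun i => ((ZMod.chineseRemainder hab) (h i)).2)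
     left_inv := fun fg => by ext i <;> simp
     right_inv := fun h => by funext i; simp
     map_add' := fun fg fg' => by
       funext i
       change (ZMod.chineseRemainder hab).symm ((fg.1 + fg'.1) i, (fg.2 + fg'.2) i) = _
       rw [Pi.add_apply, Pi.add_apply, ← Prod.mk_add_mk, map_add]
       rfl }⟩

/-- **`G[n] ≃+ (ℤ∕n)^d` FROM THE COUNTS `#G[p^m] = p^{dm}`** at the primes `p ∣ n` (all `m`), for any abelian group `G` and `n ≠ 0`: prime powers by Lang's
argument (★ `TateModule.nonempty_torsionBy_addEquiv_pi_zmod_of_card`), coprime factors by the primary decomposition (★ `nonempty_torsionBy_mul_addEquiv_prod`).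
[cite: Lang1983AbelianVarieties, Ch. VII §1 Prop. 1] [cite: SerreTate1968, §1 (p. 493)] -/
theorem nonempty_torsionBy_addEquiv_pi_zmod_of_card_primePow {G : Type v} [AddCommGroup G] {d : ℕ} :
    ∀ {n : ℕ}, n ≠ 0 →
      (∀ p : ℕ, p.Prime → p ∣ n → ∀ m : ℕ, Nat.card (AddSubgroup.torsionBy G ((p ^ m : ℕ) : ℤ)) = p ^ (d * m)) →
      Nonempty (AddSubgroup.torsionBy G (n : ℤ) ≃+ (Fin d → ZMod n)) := by
  intro n
  induction n using Nat.recOnPosPrimePosCoprime with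
  | zero => intro h; exact absurd rfl h
  | one =>
    intro _ _
    haveI : Unique (AddSubgroup.torsionBy G ((1 : ℕ) : ℤ)) :=
      ⟨⟨0⟩, fun P => Subtype.ext (by
        have h := AddSubgroup.torsionBy.nsmul_iff.mp P.2
        rwa [one_smul] at h)⟩
    haveI : Unique (Fin d → ZMod 1) := Pi.unique
    exact ⟨AddEquiv.ofUnique⟩
  | prime_pow p m hp hm =>
    intro _ hcard
    haveI := Fact.mk hp
    exact TateModule.nonempty_torsionBy_addEquiv_pi_zmod_of_card (G := G) (hcard p hp (dvd_pow_self p hm.ne')) m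
  | coprime a b ha hb hab iha ihb =>
    intro _ hcard
    obtain ⟨ea⟩ := iha (by omega) fun p hp hpa => hcard p hp (hpa.mul_right b)
    obtain ⟨eb⟩ := ihb (by omega) fun p hp hpb => hcard p hp (hpb.mul_left a)
    obtain ⟨e⟩ := Literature.AlgebraicGeometry.Motives.nonempty_torsionBy_mul_addEquiv_prod (G := G) hab
    obtain ⟨c⟩ := nonempty_pi_zmod_prod_addEquiv d hab
    exact ⟨e.trans ((AddEquiv.prodCongr ea eb).trans c)⟩

/-! ### §2 The `n`-torsion of the `Ω`-points of an abelian variety over an algebraically closed `Ω` -/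

section Points

variable {Ω : Type u} [Field Ω] [IsAlgClosed Ω] (A₀ : AbelianVariety Ω)

/-- `#(Additive A₀(Ω))[n] = n^{2 dim A₀}` for `(n : Ω) ≠ 0` (★ `natCard_torsionPoints_eq_of_isAlgClosed` at `L := Ω`, through `n • x = 0 ↔ x^n = 1`).
[cite: MumfordAV1970, §6 Application 3 (Proposition p. 64)] -/
theorem natCard_torsionBy_additive_points (n : ℕ) (hn : (n : Ω) ≠ 0) :
    Nat.card (AddSubgroup.torsionBy (Additive (A₀.Points Ω)) (n : ℤ)) = n ^ (2 * A₀.dim) := by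
  have e : AddSubgroup.torsionBy (Additive (A₀.Points Ω)) (n : ℤ) ≃ A₀.torsionPoints Ω (n : ℤ) :=
    { toFun := fun x => ⟨Additive.toMul x.1, by
        rw [AbelianVariety.mem_torsionPoints_iff, zpow_natCast, ← toMul_nsmul, AddSubgroup.torsionBy.nsmul_iff.mp x.2, toMul_zero]⟩
      invFun := fun P => ⟨Additive.ofMul P.1, by
        rw [AddSubgroup.torsionBy.nsmul_iff, ← ofMul_pow, ← zpow_natCast, (AbelianVariety.mem_torsionPoints_iff _ _).mp P.2, ofMul_one]⟩
      left_inv := fun x => rfl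
      right_inv := fun P => rfl }
  rw [Nat.card_congr e, A₀.natCard_torsionPoints_eq_of_isAlgClosed Ω (n : ℤ) (by exact_mod_cast hn), Int.natAbs_natCast]

/-- **`A₀(Ω)[n] ≃+ (ℤ∕n)^{2 dim A₀}`** for an abelian variety over an ALGEBRAICALLY CLOSED `Ω` and `(n : Ω) ≠ 0` (counts at the prime powers dividing `n` + §1).
[cite: MumfordAV1970, §6 Application 3 (Proposition p. 64)] [cite: SerreTate1968, §1 (p. 493)] -/
theorem nonempty_torsionBy_additive_points_addEquiv_pi_zmod (n : ℕ) (hn : (n : Ω) ≠ 0) :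
    Nonempty (AddSubgroup.torsionBy (Additive (A₀.Points Ω)) (n : ℤ) ≃+ (Fin (2 * A₀.dim) → ZMod n)) := by
  have hn0 : n ≠ 0 := by rintro rfl; exact hn Nat.cast_zero
  refine nonempty_torsionBy_addEquiv_pi_zmod_of_card_primePow hn0 fun p _ hpn m => ?_
  have hp0 : (p : Ω) ≠ 0 := fun h0 => hn (by
    obtain ⟨c, rfl⟩ := hpn
    rw [Nat.cast_mul, h0, zero_mul])
  have hp : ((p ^ m : ℕ) : Ω) ≠ 0 := by
    rw [Nat.cast_pow]
    exact pow_ne_zero m hp0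
  rw [natCard_torsionBy_additive_points A₀ (p ^ m) hp, ← pow_mul, mul_comm]

/-- **A `ℤ∕n`-BASIS OF `A₀[n](Ω)` over an algebraically closed `Ω`, `(n : Ω) ≠ 0`**, in the currency of ★ `LevelStructure.exists_of_torsionBasis`: `2g` points
`x : Fin g ⊕ Fin g → A₀(Ω)` with `xᵢ^n = 1` on which `a ↦ ∏ᵢ x(inl i)^{a(inl i)} · ∏ᵢ x(inr i)^{a(inr i)}` is injective (`g = dim A₀`).
[cite: MumfordAV1970, §6 Application 3 (Proposition p. 64)] [cite: MumfordFogartyKirwan1994, Ch. 7 §2 Definition 7.1 (p. 129)] -/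
theorem exists_torsionBasis (n : ℕ) (hn : (n : Ω) ≠ 0) {g : ℕ} (hg : A₀.dim = g) :
    ∃ x : Fin g ⊕ Fin g → A₀.Points Ω, (∀ i, x i ^ n = 1) ∧
      Function.Injective fun a : Fin g ⊕ Fin g → ZMod n =>
        (List.ofFn fun i : Fin g => x (Sum.inl i) ^ (a (Sum.inl i)).val).prod *
          (List.ofFn fun i : Fin g => x (Sum.inr i) ^ (a (Sum.inr i)).val).prod := by
  have hn0 : n ≠ 0 := by rintro rfl; exact hn Nat.cast_zero
  haveI : NeZero n := ⟨hn0⟩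
  obtain ⟨e⟩ := nonempty_torsionBy_additive_points_addEquiv_pi_zmod A₀ n hn
  -- reindex `Fin g ⊕ Fin g ≃ Fin (2 * dim)`
  let σ : Fin g ⊕ Fin g ≃ Fin (2 * A₀.dim) := finSumFinEquiv.trans (finCongr (by rw [hg, two_mul]))
  -- the basis vectors
  let b : Fin g ⊕ Fin g → AddSubgroup.torsionBy (Additive (A₀.Points Ω)) (n : ℤ) := fun i => e.symm (Pi.single (σ i) 1)
  let x : Fin g ⊕ Fin g → A₀.Points Ω := fun i => Additive.toMul ((b i : Additive (A₀.Points Ω)))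
  have hx : ∀ i, x i ^ n = 1 := fun i => by
    change Additive.toMul ((b i : Additive (A₀.Points Ω))) ^ n = 1
    rw [← toMul_nsmul, AddSubgroup.torsionBy.nsmul_iff.mp (b i).2, toMul_zero]
  refine ⟨x, hx, ?_⟩
  -- the product map is `a ↦ toMul (e.symm (a ∘ σ.symm))`
  have key : ∀ a : Fin g ⊕ Fin g → ZMod n,
      (List.ofFn fun i : Fin g => x (Sum.inl i) ^ (a (Sum.inl i)).val).prod *
          (List.ofFn fun i : Fin g => x (Sum.inr i) ^ (a (Sum.inr i)).val).prod =
        Additive.toMul ((e.symm (fun j => a (σ.symm j)) : Additive (A₀.Points Ω))) := by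
    intro a
    rw [List.prod_ofFn, List.prod_ofFn, ← Fintype.prod_sum_type (f := fun i => x i ^ (a i).val)]
    -- decompose `a ∘ σ.symm` on the standard basis
    have hdec : (fun j => a (σ.symm j)) = ∑ j, (a (σ.symm j)).val • Pi.single j (1 : ZMod n) := by
      funext j
      rw [Finset.sum_apply, Finset.sum_eq_single j, Pi.smul_apply, Pi.single_eq_same, nsmul_eq_mul, mul_one,
        ZMod.natCast_zmod_val]
      · intro k _ hkj
        rw [Pi.smul_apply, Pi.single_eq_of_ne (Ne.symm hkj), smul_zero]
      · exact fun h => absurd (Finset.mem_univ j) h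
    rw [hdec, map_sum, AddSubmonoidClass.coe_finsetSum, toMul_sum]
    refine Fintype.prod_equiv σ _ _ fun i => ?_
    rw [Equiv.symm_apply_apply, map_nsmul, AddSubmonoidClass.coe_nsmul, toMul_nsmul]
  intro a a' h
  have h' : (fun j => a (σ.symm j)) = fun j => a' (σ.symm j) := by
    have h1 := h
    simp only [key] at h1
    exact e.symm.injective (Subtype.ext (Additive.toMul.injective h1))
  funext i
  have := congrFun h' (σ i)
  simpa only [Equiv.symm_apply_apply] using this

end Points

/-! ### §3 The head: a level-`n` structure over an algebraically closed field -/

section Head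

variable {Ω : Type u} [Field Ω]

variable [IsAlgClosed Ω]

/-- **H6 «LEVEL-κ̄»: EVERY ABELIAN SCHEME OVER AN ALGEBRAICALLY CLOSED FIELD CARRIES A LEVEL-`n` STRUCTURE, `n` INVERTIBLE.**  For `Ω` algebraically closed,
`A → Spec Ω` an abelian scheme of relative dimension `g` and `(n : Ω) ≠ 0`: `Nonempty (LevelStructure g n A)` (a `ℤ∕n`-basis of `A[n](Ω)`, §2, read as
`2g` sections through ★ `LevelStructure.exists_of_torsionBasis` and the definitional identity `ofAbelianVariety A.toAffine.toAbelianVariety = A`).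
[cite: MumfordFogartyKirwan1994, Ch. 7 §2 Definition 7.1 (p. 129)] [cite: MumfordAV1970, §6 Application 3 (Proposition p. 64)] -/
theorem nonempty_levelStructure_of_isAlgClosed (A : AbelianSchemeOver (Spec (.of Ω))) {g n : ℕ} (hg : A.IsOfRelDim g)
    (hn : (n : Ω) ≠ 0) : Nonempty (LevelStructure g n A) := by
  obtain ⟨x, hx, hinj⟩ := exists_torsionBasis A.toAffine.toAbelianVariety n hn (dim_toAffine_toAbelianVariety_of_isOfRelDim hg)
  obtain ⟨φ, -⟩ := LevelStructure.exists_of_torsionBasis A.toAffine.toAbelianVariety (dim_toAffine_toAbelianVariety_of_isOfRelDim hg) hn x hx hinj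
  exact ⟨φ⟩

/-- `∃`-form of the head, with the values of the sections: there are a level-`n` structure `φ` and `Ω`-points `xᵢ` with `(φ.σ i).left = (x i).left`.
[cite: MumfordFogartyKirwan1994, Ch. 7 §2 Definition 7.1 (p. 129)] -/
theorem exists_levelStructure_of_isAlgClosed (A : AbelianSchemeOver (Spec (.of Ω))) {g n : ℕ} (hg : A.IsOfRelDim g)
    (hn : (n : Ω) ≠ 0) :
    ∃ (φ : LevelStructure g n A) (x : Fin g ⊕ Fin g → A.toAffine.toAbelianVariety.Points Ω),
      (∀ i, x i ^ n = 1) ∧ ∀ i, @Eq (Spec (.of Ω) ⟶ A.X.left) (φ.σ i).left (x i).left := by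
  obtain ⟨x, hx, hinj⟩ := exists_torsionBasis A.toAffine.toAbelianVariety n hn (dim_toAffine_toAbelianVariety_of_isOfRelDim hg)
  obtain ⟨φ, hφ⟩ := LevelStructure.exists_of_torsionBasis A.toAffine.toAbelianVariety (dim_toAffine_toAbelianVariety_of_isOfRelDim hg) hn x hx hinj
  exact ⟨φ, x, hx, hφ⟩

end Head

end AbelianSchemeOver

end Literature.AlgebraicGeometry.AbelianSchemes

end
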